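import Summits.CriticalPhenomena.PercolationContinuityZ3.Theorems.PercNearOneGluingNoHeavyQuantRootDecFloorSplit
import HarnessLib

/-!
# QUANT lane R8 — "at most `r` open": the calculus of `AMR[r, T, q]` and the `(r+1)`-COMPLETION TERM rule (any `r`)

builds on p205010 (kernel theorem, internal audit signed; external expert review pending)

Support file (`--supports stmt-CriticalPhenomena-4575`), QUANT lane typer seat prim-quant-stmt (gen 20).  Theorems only; local notation.  Generalises
`…QuantAtMostOne` (`r = 1`) and rule ∨ `term_ge_disj_giants` (`r = 0`).

For closure probabilities `q` and a finset `T`, `AMR[r, T, q] = Σ_{O ⊆ T, |O| ≤ r} ∏_{O}(1 − q) ∏_{T∖O} q` is the probability that AT MOST `r` blobs of `T`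
are open.

* `Quant.IndepBlob.amr_insert` — `AMR[r+1, insert a T, q] = q a·AMR[r+1, T, q] + (1 − q a)·AMR[r, T, q]` (`a ∉ T`); `amr_zero_eq_prod` (`AMR[0, T, q] = ∏_T q`).
* `Quant.IndepBlob.amr_nonneg`, `amr_mono_r` (`AMR[r] ≤ AMR[r+1]`), `amr_le_one`, `amr_mono` (monotone in `q`), `amr_insert_le`, `amr_le_of_subset`.
* **`Quant.RootDec.term_ge_one_sub_amr` — THE `(r+1)`-COMPLETION TERM RULE**: gates in `[0,1]`; if every `(r+1)`-subset of `T` completes at the sure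
  part `s` (`j + 1 ≤ s + Σ_{U} a` for `U ⊆ T`, `|U| = r+1`) then `1 − AMR[r, T, 1 − g] ≤ TERM[s, a, g, j]` — the term is at least the probability
  that at least `r+1` blobs of `T` are open (induction on `T`, generalising `r` and `s`, by `term_cond`).
[this work]; the gluing rows served [cite: KozmaNitzan2024, Conjecture 3 (p. 15)]; product weights [cite: Grimmett1999, §1.3 p. 10].
-/

namespace Summit.CriticalPhenomena.PercolationContinuityZ3.Theorems

namespace Quant

namespace IndepBlob

open Finset

variable {κ : Type} [DecidableEq κ]

/-- probability that at most `r` blobs of `T` are open, closure probabilities `q` -/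
local notation3 "AMR[" r ", " T ", " q "]" =>
  ∑ O ∈ ((T : Finset κ).powerset.filter (fun O => O.card ≤ (r : ℕ))),
    (∏ k ∈ O, (1 - (q : κ → ℝ) k)) * ∏ k ∈ (T : Finset κ) \ O, (q : κ → ℝ) k

/-! ### 1. Recursion and range -/

/-- `AMR[0, T, q] = ∏_{T} q`. [this work] -/
theorem amr_zero_eq_prod (T : Finset κ) (q : κ → ℝ) : AMR[0, T, q] = ∏ k ∈ T, q k := by
  have hf : T.powerset.filter (fun O => O.card ≤ 0) = {∅} := by
    ext O
    simp only [Finset.mem_filter, Finset.mem_powerset, Nat.le_zero, Finset.card_eq_zero, Finset.mem_singleton]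
    constructor
    · rintro ⟨_, h⟩; exact h
    · rintro rfl; exact ⟨Finset.empty_subset _, rfl⟩
  rw [hf, Finset.sum_singleton, Finset.prod_empty, one_mul, Finset.sdiff_empty]

/-- **Conditioning on one blob**: `AMR[r+1, insert a T, q] = q a·AMR[r+1, T, q] + (1 − q a)·AMR[r, T, q]` for `a ∉ T`. [this work] -/
theorem amr_insert (r : ℕ) (T : Finset κ) (q : κ → ℝ) (a : κ) (ha : a ∉ T) :
    AMR[r + 1, insert a T, q] = q a * AMR[r + 1, T, q] + (1 - q a) * AMR[r, T, q] := by
  rw [Finset.powerset_insert, Finset.filter_union, Finset.sum_union]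
  · -- first part: `O ⊆ T`, `a ∉ O`: the closed factor picks up `q a`
    have h1 : ∑ O ∈ T.powerset.filter (fun O => O.card ≤ r + 1), (∏ k ∈ O, (1 - q k)) * ∏ k ∈ insert a T \ O, q k =
        q a * AMR[r + 1, T, q] := by
      rw [Finset.mul_sum]
      refine Finset.sum_congr rfl fun O hO => ?_
      have hOT : O ⊆ T := Finset.mem_powerset.1 (Finset.mem_filter.1 hO).1
      have haO : a ∉ O := fun h => ha (hOT h)
      rw [Finset.insert_sdiff_of_notMem T haO, Finset.prod_insert (fun h => ha (Finset.mem_sdiff.1 h).1)]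
      ring
    -- second part: `O = insert a O'`, `O' ⊆ T`: the open factor picks up `1 − q a`, the cardinality drops by one
    have h2 : ∑ O ∈ (T.powerset.image (insert a)).filter (fun O => O.card ≤ r + 1),
        (∏ k ∈ O, (1 - q k)) * ∏ k ∈ insert a T \ O, q k = (1 - q a) * AMR[r, T, q] := by
      rw [Finset.filter_image, Finset.sum_image, Finset.mul_sum]
      · -- the filtered sets agree
        have hf : T.powerset.filter (fun O => (insert a O).card ≤ r + 1) = T.powerset.filter (fun O => O.card ≤ r) := by
          ext O
          simp only [Finset.mem_filter, Finset.mem_powerset, and_congr_right_iff]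
          intro hOT
          rw [Finset.card_insert_of_notMem (fun h => ha (hOT h))]
          omega
        rw [hf]
        refine Finset.sum_congr rfl fun O hO => ?_
        have hOT : O ⊆ T := Finset.mem_powerset.1 (Finset.mem_filter.1 hO).1
        have haO : a ∉ O := fun h => ha (hOT h)
        rw [Finset.prod_insert haO]
        have hs : insert a T \ insert a O = T \ O := by
          ext k
          simp only [Finset.mem_sdiff, Finset.mem_insert]
          constructor
          · rintro ⟨h1 | h1, h2⟩
            · exact absurd (Or.inl h1) h2
            · exact ⟨h1, fun h => h2 (Or.inr h)⟩
          · rintro ⟨h1, h2⟩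
            exact ⟨Or.inr h1, fun h => h.elim (fun h' => ha (h' ▸ h1)) h2⟩
        rw [hs]
        ring
      · intro O₁ hO₁ O₂ hO₂ h
        have h₁ : a ∉ O₁ := fun h' => ha (Finset.mem_powerset.1 (Finset.mem_filter.1 hO₁).1 h')
        have h₂ : a ∉ O₂ := fun h' => ha (Finset.mem_powerset.1 (Finset.mem_filter.1 hO₂).1 h')
        rw [← Finset.erase_insert h₁, ← Finset.erase_insert h₂, h]
    rw [h1, h2]
  · -- disjointness
    rw [Finset.disjoint_left]
    intro O hO hO'
    have hOT : O ⊆ T := Finset.mem_powerset.1 (Finset.mem_filter.1 hO).1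
    obtain ⟨O', _, rfl⟩ := Finset.mem_image.1 (Finset.mem_filter.1 hO').1
    exact ha (hOT (Finset.mem_insert_self a O'))

/-- `0 ≤ AMR[r, T, q]` for `q ∈ [0,1]` on `T`. [this work] -/
theorem amr_nonneg (r : ℕ) (T : Finset κ) (q : κ → ℝ) (hq : ∀ k ∈ T, 0 ≤ q k ∧ q k ≤ 1) : 0 ≤ AMR[r, T, q] := by
  refine Finset.sum_nonneg fun O hO => ?_
  have hOT : O ⊆ T := Finset.mem_powerset.1 (Finset.mem_filter.1 hO).1
  exact mul_nonneg (Finset.prod_nonneg fun k hk => sub_nonneg.2 (hq k (hOT hk)).2)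
    (Finset.prod_nonneg fun k hk => (hq k (Finset.mem_sdiff.1 hk).1).1)

/-- `AMR[r, T, q] ≤ AMR[r+1, T, q]` (more open blobs allowed). [this work] -/
theorem amr_mono_r (r : ℕ) (T : Finset κ) (q : κ → ℝ) (hq : ∀ k ∈ T, 0 ≤ q k ∧ q k ≤ 1) : AMR[r, T, q] ≤ AMR[r + 1, T, q] := by
  refine Finset.sum_le_sum_of_subset_of_nonneg (fun O hO => ?_) fun O hO _ => ?_
  · rw [Finset.mem_filter] at hO ⊢; exact ⟨hO.1, by omega⟩
  · have hOT : O ⊆ T := Finset.mem_powerset.1 (Finset.mem_filter.1 hO).1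
    exact mul_nonneg (Finset.prod_nonneg fun k hk => sub_nonneg.2 (hq k (hOT hk)).2)
      (Finset.prod_nonneg fun k hk => (hq k (Finset.mem_sdiff.1 hk).1).1)

/-- `AMR[r, T, q] ≤ 1` for `q ∈ [0,1]` on `T`. [this work] -/
theorem amr_le_one (T : Finset κ) (q : κ → ℝ) (hq : ∀ k ∈ T, 0 ≤ q k ∧ q k ≤ 1) : ∀ r : ℕ, AMR[r, T, q] ≤ 1 := by
  induction T using Finset.induction_on with
  | empty =>
    intro r
    have hf : (∅ : Finset κ).powerset.filter (fun O => O.card ≤ r) = {∅} := by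
      rw [Finset.powerset_empty]; ext O; simp only [Finset.mem_filter, Finset.mem_singleton]
      exact ⟨fun h => h.1, fun h => ⟨h, by rw [h]; simp⟩⟩
    rw [hf]; simp
  | insert a T ha ih =>
    intro r
    have hqT : ∀ k ∈ T, 0 ≤ q k ∧ q k ≤ 1 := fun k hk => hq k (Finset.mem_insert_of_mem hk)
    have hqa := hq a (Finset.mem_insert_self a T)
    rcases Nat.eq_zero_or_pos r with hr | hr
    · subst hr
      rw [amr_zero_eq_prod]
      exact Finset.prod_le_one (fun k hk => (hq k hk).1) fun k hk => (hq k hk).2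
    · obtain ⟨r, rfl⟩ : ∃ r', r = r' + 1 := ⟨r - 1, by omega⟩
      rw [amr_insert r T q a ha]
      have h1 := ih hqT (r + 1)
      have h2 := ih hqT r
      nlinarith [mul_le_mul_of_nonneg_left h1 hqa.1, mul_le_mul_of_nonneg_left h2 (sub_nonneg.2 hqa.2)]

/-! ### 2. Monotonicity -/

/-- **Monotone in the closure probabilities**: `0 ≤ q ≤ q' ≤ 1` on `T` ⟹ `AMR[r, T, q] ≤ AMR[r, T, q']`. [this work] -/
theorem amr_mono (T : Finset κ) (q q' : κ → ℝ) (hq : ∀ k ∈ T, 0 ≤ q k ∧ q k ≤ q' k ∧ q' k ≤ 1) :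
    ∀ r : ℕ, AMR[r, T, q] ≤ AMR[r, T, q'] := by
  induction T using Finset.induction_on with
  | empty =>
    intro r
    have hf : (∅ : Finset κ).powerset.filter (fun O => O.card ≤ r) = {∅} := by
      rw [Finset.powerset_empty]; ext O; simp only [Finset.mem_filter, Finset.mem_singleton]
      exact ⟨fun h => h.1, fun h => ⟨h, by rw [h]; simp⟩⟩
    rw [hf]; simp
  | insert a T ha ih =>
    intro r
    have hqT : ∀ k ∈ T, 0 ≤ q k ∧ q k ≤ q' k ∧ q' k ≤ 1 := fun k hk => hq k (Finset.mem_insert_of_mem hk)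
    have hq'T : ∀ k ∈ T, 0 ≤ q' k ∧ q' k ≤ 1 := fun k hk => ⟨(hqT k hk).1.trans (hqT k hk).2.1, (hqT k hk).2.2⟩
    have hqT' : ∀ k ∈ T, 0 ≤ q k ∧ q k ≤ 1 := fun k hk => ⟨(hqT k hk).1, (hqT k hk).2.1.trans (hqT k hk).2.2⟩
    have hqa := hq a (Finset.mem_insert_self a T)
    rcases Nat.eq_zero_or_pos r with hr | hr
    · subst hr
      rw [amr_zero_eq_prod, amr_zero_eq_prod]
      exact Finset.prod_le_prod (fun k hk => (hq k hk).1) fun k hk => (hq k hk).2.1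
    · obtain ⟨r, rfl⟩ : ∃ r', r = r' + 1 := ⟨r - 1, by omega⟩
      rw [amr_insert r T q a ha, amr_insert r T q' a ha]
      have hA := ih hqT (r + 1)
      have hB := ih hqT r
      have hBA : AMR[r, T, q'] ≤ AMR[r + 1, T, q'] := amr_mono_r r T q' hq'T
      have h1 : q a * AMR[r + 1, T, q] ≤ q a * AMR[r + 1, T, q'] := mul_le_mul_of_nonneg_left hA hqa.1
      have h2 : (1 - q a) * AMR[r, T, q] ≤ (1 - q a) * AMR[r, T, q'] :=
        mul_le_mul_of_nonneg_left hB (by linarith [hqa.2.1, hqa.2.2])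
      have h3 : 0 ≤ (q' a - q a) * (AMR[r + 1, T, q'] - AMR[r, T, q']) :=
        mul_nonneg (sub_nonneg.2 hqa.2.1) (sub_nonneg.2 hBA)
      nlinarith [h1, h2, h3]

/-- Adding a blob lowers `AMR`: `AMR[r, insert a T, q] ≤ AMR[r, T, q]` (`q ∈ [0,1]` on `insert a T`). [this work] -/
theorem amr_insert_le (r : ℕ) (T : Finset κ) (q : κ → ℝ) (a : κ) (hq : ∀ k ∈ insert a T, 0 ≤ q k ∧ q k ≤ 1) :
    AMR[r, insert a T, q] ≤ AMR[r, T, q] := by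
  by_cases ha : a ∈ T
  · rw [Finset.insert_eq_of_mem ha]
  have hqT : ∀ k ∈ T, 0 ≤ q k ∧ q k ≤ 1 := fun k hk => hq k (Finset.mem_insert_of_mem hk)
  have hqa := hq a (Finset.mem_insert_self a T)
  rcases Nat.eq_zero_or_pos r with hr | hr
  · subst hr
    rw [amr_zero_eq_prod, amr_zero_eq_prod, Finset.prod_insert ha]
    exact mul_le_of_le_one_left (Finset.prod_nonneg fun k hk => (hqT k hk).1) hqa.2
  · obtain ⟨r, rfl⟩ : ∃ r', r = r' + 1 := ⟨r - 1, by omega⟩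
    rw [amr_insert r T q a ha]
    have hBA := amr_mono_r r T q hqT
    nlinarith [mul_le_mul_of_nonneg_left hBA (sub_nonneg.2 hqa.2)]

/-- `AMR[r, S ∪ U, q] ≤ AMR[r, S, q]` (`q ∈ [0,1]` on `S ∪ U`). [this work] -/
theorem amr_union_le (r : ℕ) (S U : Finset κ) (q : κ → ℝ) (hq : ∀ k ∈ S ∪ U, 0 ≤ q k ∧ q k ≤ 1) :
    AMR[r, S ∪ U, q] ≤ AMR[r, S, q] := by
  induction U using Finset.induction_on with
  | empty => simp
  | insert a U _ ih =>
    have hq' : ∀ k ∈ S ∪ U, 0 ≤ q k ∧ q k ≤ 1 := fun k hk =>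
      hq k (by rw [Finset.union_insert]; exact Finset.mem_insert_of_mem hk)
    rw [Finset.union_insert]
    exact (amr_insert_le r (S ∪ U) q a (by rw [← Finset.union_insert]; exact hq)).trans (ih hq')

/-- **Monotone in the set**: `S ⊆ T` ⟹ `AMR[r, T, q] ≤ AMR[r, S, q]` (`q ∈ [0,1]` on `T`). [this work] -/
theorem amr_le_of_subset (r : ℕ) (S T : Finset κ) (hST : S ⊆ T) (q : κ → ℝ) (hq : ∀ k ∈ T, 0 ≤ q k ∧ q k ≤ 1) :
    AMR[r, T, q] ≤ AMR[r, S, q] := by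
  have hT : T = S ∪ (T \ S) := (Finset.union_sdiff_of_subset hST).symm
  rw [hT]
  exact amr_union_le r S (T \ S) q (by rw [← hT]; exact hq)

/-- `r + 1` sure blobs kill `AMR[r]`: if `S ⊆ T`, `|S| = r + 1` and `q = 0` on `S` then `AMR[r, T, q] = 0` (`q ∈ [0,1]` on `T`). [this work] -/
theorem amr_eq_zero_of_sure (r : ℕ) (S T : Finset κ) (hST : S ⊆ T) (hS : S.card = r + 1) (q : κ → ℝ)
    (hq : ∀ k ∈ T, 0 ≤ q k ∧ q k ≤ 1) (h0 : ∀ k ∈ S, q k = 0) : AMR[r, T, q] = 0 := by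
  refine le_antisymm ((amr_le_of_subset r S T hST q hq).trans (le_of_eq ?_)) (amr_nonneg r T q hq)
  refine Finset.sum_eq_zero fun O hO => ?_
  have hOS : O ⊆ S := Finset.mem_powerset.1 (Finset.mem_filter.1 hO).1
  have hcard : O.card ≤ r := (Finset.mem_filter.1 hO).2
  -- `S \ O` is non-empty, and carries a factor `q = 0`
  have hne : (S \ O).Nonempty := by
    rw [← Finset.card_pos, Finset.card_sdiff_of_subset hOS]; omega
  obtain ⟨k, hk⟩ := hne
  rw [Finset.prod_eq_zero hk (h0 k (Finset.mem_sdiff.1 hk).1), mul_zero]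

end IndepBlob

namespace RootDec

open Finset

variable {κ : Type} [Fintype κ] [DecidableEq κ]

/-- product-Bernoulli weight of the set `W` of open blobs (as in `…QuantRootReduction`) -/
local notation3 "wt[" g ", " W "]" => ∏ k, (if k ∈ (W : Finset κ) then (g : κ → ℝ) k else 1 - (g : κ → ℝ) k)

/-- the TERM tail `P(s + Σ_{k open} a k ≥ j+1)` (as in `…QuantRootReduction`) -/
local notation3 "TERM[" s ", " a ", " g ", " j "]" =>
  ∑ W : Finset κ, wt[g, W] * (if (j : ℕ) + 1 ≤ (s : ℕ) + ∑ k ∈ W, (a : κ → ℕ) k then (1 : ℝ) else 0)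

/-- probability that at most `r` blobs of `T` are open (as in `Quant.IndepBlob`) -/
local notation3 "AMR[" r ", " T ", " q "]" =>
  ∑ O ∈ ((T : Finset κ).powerset.filter (fun O => O.card ≤ (r : ℕ))),
    (∏ k ∈ O, (1 - (q : κ → ℝ) k)) * ∏ k ∈ (T : Finset κ) \ O, (q : κ → ℝ) k

/-! ### 3. The `(r+1)`-completion TERM rule -/

/-- **THE `(r+1)`-COMPLETION TERM RULE.**  Gates in `[0,1]`; if every `(r+1)`-subset `U` of `T` completes at the sure part `s`
(`j + 1 ≤ s + Σ_{U} a`), then `1 − AMR[r, T, 1 − g] ≤ TERM[s, a, g, j]`: the term is at least the probability that at least `r + 1` blobs of `T` are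
open.  (`r = 0` is rule ∨; `r = 1` is the pair rule `term_ge_one_sub_amo`.  Induction on `T` generalising `r`, `s`, `a`: condition on `k₀ ∈ T`; open
branch = the `r`-version for `T ∖ k₀` at `s + a k₀`; closed branch = the induction hypothesis; recombine with `amr_insert`.) [this work] -/
theorem term_ge_one_sub_amr (g : κ → ℝ) (j : ℕ) (hg : ∀ k, 0 ≤ g k ∧ g k ≤ 1) (T : Finset κ) :
    ∀ (r s : ℕ) (a : κ → ℕ), (∀ U ∈ T.powersetCard (r + 1), j + 1 ≤ s + ∑ k ∈ U, a k) →
      1 - AMR[r, T, fun k => 1 - g k] ≤ TERM[s, a, g, j] := by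
  induction T using Finset.induction_on with
  | empty =>
    intro r s a _
    have hf : (∅ : Finset κ).powerset.filter (fun O => O.card ≤ r) = {∅} := by
      rw [Finset.powerset_empty]; ext O; simp only [Finset.mem_filter, Finset.mem_singleton]
      exact ⟨fun h => h.1, fun h => ⟨h, by rw [h]; simp⟩⟩
    rw [hf]
    simp only [Finset.sum_singleton, Finset.prod_empty, Finset.sdiff_empty, mul_one, sub_self]
    exact term_nonneg s a g j hg
  | insert k₀ T hk₀ ih =>
    intro r s a hcomp
    rcases Nat.eq_zero_or_pos r with hr | hr
    · -- `r = 0`: every blob of `insert k₀ T` is a giant — rule ∨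
      subst hr
      rw [IndepBlob.amr_zero_eq_prod]
      refine term_ge_disj_giants s a g j hg (insert k₀ T) fun l hl => ?_
      have h := hcomp {l} (Finset.mem_powersetCard.2 ⟨Finset.singleton_subset_iff.2 hl, Finset.card_singleton l⟩)
      simpa using h
    · obtain ⟨r, rfl⟩ : ∃ r', r = r' + 1 := ⟨r - 1, by omega⟩
      rw [IndepBlob.amr_insert r T (fun k => 1 - g k) k₀ hk₀, term_cond s a g j k₀]
      -- open branch: every `(r+1)`-subset of `T` completes at `s + a k₀`
      have hA : 1 - AMR[r, T, fun k => 1 - g k] ≤ TERM[s + a k₀, Function.update a k₀ 0, g, j] := by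
        refine ih r (s + a k₀) (Function.update a k₀ 0) fun U hU => ?_
        have hUT : U ⊆ T := (Finset.mem_powersetCard.1 hU).1
        have hk₀U : k₀ ∉ U := fun h => hk₀ (hUT h)
        have h := hcomp (insert k₀ U) (Finset.mem_powersetCard.2
          ⟨Finset.insert_subset_insert k₀ hUT, by rw [Finset.card_insert_of_notMem hk₀U, (Finset.mem_powersetCard.1 hU).2]⟩)
        rw [Finset.sum_insert hk₀U] at h
        have e : ∑ k ∈ U, Function.update a k₀ 0 k = ∑ k ∈ U, a k :=
          Finset.sum_congr rfl fun k hk => Function.update_of_ne (fun h' : k = k₀ => hk₀U (h' ▸ hk)) (0 : ℕ) a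
        rw [e]
        omega
      -- closed branch: induction hypothesis at level `r + 1`
      have hB : 1 - AMR[r + 1, T, fun k => 1 - g k] ≤ TERM[s, Function.update a k₀ 0, g, j] := by
        refine ih (r + 1) s (Function.update a k₀ 0) fun U hU => ?_
        have hUT : U ⊆ T := (Finset.mem_powersetCard.1 hU).1
        have hk₀U : k₀ ∉ U := fun h => hk₀ (hUT h)
        have h := hcomp U (Finset.mem_powersetCard.2 ⟨hUT.trans (Finset.subset_insert k₀ T), (Finset.mem_powersetCard.1 hU).2⟩)
        have e : ∑ k ∈ U, Function.update a k₀ 0 k = ∑ k ∈ U, a k :=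
          Finset.sum_congr rfl fun k hk => Function.update_of_ne (fun h' : k = k₀ => hk₀U (h' ▸ hk)) (0 : ℕ) a
        rw [e]
        exact h
      have h1 := mul_le_mul_of_nonneg_left hA (hg k₀).1
      have h2 := mul_le_mul_of_nonneg_left hB (sub_nonneg.2 (hg k₀).2)
      have e : (1 : ℝ) - (1 - g k₀) = g k₀ := by ring
      rw [e]
      nlinarith [h1, h2]

end RootDec

end Quant

end Summit.CriticalPhenomena.PercolationContinuityZ3.Theorems
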